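import Summits.BirchSwinnertonDyer.Rank1Residual.X10.MuTransferThreeOfFine
import Summits.BirchSwinnertonDyer.Rank1Residual.X10.MuTransferThreeRankOneAnyImage
import HarnessLib

/-!
# N2 (class X10b, `p = 3`) and class X10 PER PAIR, MODULO KATO'S ZETA-ELEMENT PACKAGE F1 ALONE —
# companion of `X10/MuTransferThreeOfFine.lean`: the rank-`1` forms, Miller's `BSD(E,3)` at the
# `3 ∤ #Ш_an` pairs in BOTH ranks (N2, and class X10 with either image), and the literal-model RECORD
# shapes — with the node `KatoMuTransferThree`, Kato's Thm. 17.4 at the pair and the Mazur–Tate `σ` ALL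
# discharged (cell `b2b-bsdres`, unit `b2b-bsdres-x10` = N2 class lead, GEN 41; TOOL — theorems only, no
# definition, no named fact, nothing booked)

HONEST FRAMING (run/shared/lean/b2b/bsd-rank1-residual/, verbatim in every file): the goal of the
cell is to DELETE the COMBINATION-SHAPED residual classes of the Birch–Swinnerton-Dyer formula for
ALL analytic-rank `≤ 1` elliptic curves over `ℚ` — "full BSD formula for every rank `≤ 1` curve in
class `C`" assembled STRICTLY from published theorems — so that the rank-`≤ 1` remainder becomes
exactly the CONSTRUCTION-SHAPED classes, which are TYPED (missing-input `Prop`s), NOT attempted.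
This is not "finishing BSD".  Class X10b (= N2) keeps its label CONSTRUCTION-SHAPED / NEEDS X_A3
(RESIDUAL-MAP §I N2): the class-level X_A3 needs `AnalyticMuZeroOnClassX10b` (barrier B3, class-wide),
which only per-pair certificates supply.  Nothing is booked by this file; no census word and no mark
moves; everything below is PER PAIR.  PARTITION (D-0054): X10b∧¬Surj (A5) × p = 3 (and class X10 at
`3`, either image) — types-the-object-of; closes NONE.

## What (x10 GEN 41, X10-AUDIT §47; see the companion file for §0–§2 and the full rationale)

The three cell-side binders of GEN 35/36's per-pair layer are consequences in the tree of ONE published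
construction fact F1 = `Kato2004.exists_divisibilityInputs_fineQuotient_zeta` (Kato 2004 Thm. 12.5/12.6,
Ex. 13.3, (14.9.3), Prop. 17.11, §17.13; aside 19843 of rung K6): `hT3 := X10.katoMuTransferThree_of_fine`
(GEN 40), `hK` / `hkato := X10.kato_divisibility[_three]_of_fine` (§0 of the companion; the observation of k6-c2
g6's `Theorems.smallImageMuTransfer_kato_divisibility_of_fine`, p482919), `hMT := mazur_tate_sigma_exists_odd_holds`
(x1a).  Binders that REMAIN: F1 (`hfine`); PUBLISHED `Schneider1985_order_charGenerator_odd` (`hS`),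
`perrinRiou_rankOne_leadingTerms_odd` (`hPR`), `nonempty_modularParametrizationData` (`hmodP`),
`rank_eq_analyticRank_of_analyticRank_le_one` (`hGZK`), `realPeriodRat_eq_unit_mul_plusPeriod_three` (`h3`);
finite per-pair certificates `hcertA` (unit coefficient of `L_3(f, α)`), `hunit` (`3 ∤ #Ш_an`), `hSch`
(Schneider certificate at rank `1`, rider I1); census data `hL` / `hr1`.

§3 rank `1`: `missingUpperBoundAt_three_rankOne_of_fine[_anyImage]`,
`bsdp_three_rankOne_of_fine_of_shaAn_unit[_anyImage]`.  §4 both ranks: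
`bsdp_three_onClassX10b_of_fine_of_shaAn_unit` (N2 — supersedes GEN 40's
`bsdp_three_of_fine_of_shaAn_unit_onClassX10b`, which still carried Kato's Thm. 17.4 at the pair, and
`bsdp_three_of_thm12_4_of_fine_of_shaAn_unit_onClassX10b`), `bsdp_three_onClassX10_of_fine_of_shaAn_unit`
(EITHER image: X10a′ through the good-ordinary tower + Kato (3), X10b through the `μ`-transfer).  §5 the
literal-model RECORD shapes (`MuZeroRoad` namespace): `bsdp_three_of_ainvs_of_fine_of_shaAn_unit`,
`mazurMainConjecture_three_of_ainvs_of_fine_of_bsdp`, `missingUpperBoundAt_three_of_ainvs_of_fine`.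

READING for N2 (evidence; no label moves): per pair and flag-free, `BSD(E,3)` at the 292 N2 cells with
`3 ∤ #Ш_an` rests on EXACTLY ONE cell-external open input — the published construction fact F1 — plus
refereed-in-print named facts and finite certificates (+ the Schneider rider at rank `1`).

References: K. Kato, Astérisque 295 (2004) Thm. 12.6 (p. 222), Thm. 17.4 (p. 273), §17.13 (pp. 279–280)
[Kato2004Asterisque]; R. Greenberg, LNM 1716 (1999) Conj. 1.11, Thm. 4.1 [GreenbergLNM1716]; B.
Perrin-Riou, Bull. SMF 115 (1987) §1.4 Cor. 1.8 [PerrinRiou1987]; J. Balakrishnan, J. S. Müller, W. Stein,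
Math. Comp. 85 (2016) Thm. 1.7 [BalakrishnanMullerStein2015]; C. Wuthrich, Doc. Math. 19 (2014) Lemma 20
[Wuthrich2014]; B. Mazur, Invent. Math. 44 (1978) Prop. 6.3 (1) [Mazur1978]; R. L. Miller, LMS J. Comput.
Math. 14 (2011) Def. 1.1 [Miller2011LMS]; cell files X10-AUDIT.md §40–§47.
-/

set_option autoImplicit false

noncomputable section

open scoped Classical MatrixGroups ModularForm

open CongruenceSubgroup WeierstrassCurve Field Literature.NumberTheory.GaloisRepresentations
  Literature.NumberTheory.GaloisCohomology Literature.NumberTheory.EllipticCurves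
  Literature.NumberTheory.EllipticCurves.ModularForms Literature.NumberTheory.EllipticCurves.Rank1Residual
  Literature.NumberTheory.EllipticCurves.Rank1Residual.Typed
  Literature.NumberTheory.EllipticCurves.Wuthrich2014
  Literature.NumberTheory.EllipticCurves.Kato2004 Literature.NumberTheory.EllipticCurves.Kato2004.EulerSystemValues
  Literature.NumberTheory.EllipticCurves.Rank1Residual.X11RankOneCertificates
  Summit.BirchSwinnertonDyer.BirchSwinnertonDyer.Rank1Residual.IntModel
  Summit.BirchSwinnertonDyer.BirchSwinnertonDyer.Rank1Residual.X11RankOne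
  Summit.BirchSwinnertonDyer.BirchSwinnertonDyer.Theorems.Rank1ResidualX1Defs
  Summit.BirchSwinnertonDyer.BirchSwinnertonDyer.Rank1Residual

namespace Summit.BirchSwinnertonDyer.Rank1Residual.X10

/-! ### §3. N2 and class X10 at rank `1`, modulo F1 (+ the Schneider certificate, rider I1) -/

section RankOne

variable (W : WeierstrassCurve ℚ) [W.IsElliptic] [W.IsGloballyMinimal]

/-- **N2 ∩ {r = 1}: F1 ∧ certificate ⟹ the Euler-system half `ord₃ #Ш(E/ℚ) ≤ ord₃ #Ш(E/ℚ)_an`**,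
modulo the Schneider certificate `hSch` (GEN 35's
`missingUpperBoundAt_three_rankOne_of_katoMuTransferThree`, `hT3`/`hK`/`hMT` discharged).
[cite: Kato2004Asterisque, Thm. 17.4 (2) (p. 273) and §17.13 (pp. 279–280)] [cite: PerrinRiou1987, §1.4 Cor. 1.8]
[cite: BalakrishnanMullerStein2015, Thm. 1.7] -/
theorem missingUpperBoundAt_three_rankOne_of_fine (hfine : exists_divisibilityInputs_fineQuotient_zeta)
    (hS : Schneider1985_order_charGenerator_odd) (hPR : perrinRiou_rankOne_leadingTerms_odd)
    (hmodP : nonempty_modularParametrizationData)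
    (hGZK : rank_eq_analyticRank_of_analyticRank_le_one)
    (h3 : realPeriodRat_eq_unit_mul_plusPeriod_three)
    (hX : ClassX10 W 3) (hns : ¬ Surj W 3) (hr1 : W.analyticRank = 1)
    (hSch : ∀ Dh : PAdicHeightData W 3, Dh.IsCanonical → SchneiderConjecture Dh)
    (hcertA : ∀ {N : ℕ} [NeZero N] (f : CuspForm (Gamma0 N) 2), IsNewformOf W f →
      ∃ n : ℕ, ‖PowerSeries.coeff n (padicLFunction f (unitRoot W 3 : ℚ_[3]))‖ = 1) :
    Typed.MissingUpperBoundAt W 3 :=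
  missingUpperBoundAt_three_rankOne_of_katoMuTransferThree W hS hPR mazur_tate_sigma_exists_odd_holds hmodP
    hGZK h3 (katoMuTransferThree_of_fine hfine) (kato_divisibility_three_of_fine hfine W) hX hns hr1 hSch
    hcertA

/-- **Class X10 ∩ {r = 1}, EITHER image: F1 ∧ certificate ⟹ the Euler-system half**, modulo `hSch`
(GEN 35's `missingUpperBoundAt_three_rankOne_of_katoMuTransferThree_anyImage`, `hT3`/`hK`/`hMT`
discharged). [cite: Kato2004Asterisque, Thm. 17.4 (2), (3) (p. 273) and §17.13 (pp. 279–280)]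
[cite: PerrinRiou1987, §1.4 Cor. 1.8] [cite: BalakrishnanMullerStein2015, Thm. 1.7] -/
theorem missingUpperBoundAt_three_rankOne_of_fine_anyImage
    (hfine : exists_divisibilityInputs_fineQuotient_zeta)
    (hS : Schneider1985_order_charGenerator_odd) (hPR : perrinRiou_rankOne_leadingTerms_odd)
    (hmodP : nonempty_modularParametrizationData)
    (hGZK : rank_eq_analyticRank_of_analyticRank_le_one)
    (h3 : realPeriodRat_eq_unit_mul_plusPeriod_three)
    (hX : ClassX10 W 3) (hr1 : W.analyticRank = 1)
    (hSch : ∀ Dh : PAdicHeightData W 3, Dh.IsCanonical → SchneiderConjecture Dh)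
    (hcertA : ∀ {N : ℕ} [NeZero N] (f : CuspForm (Gamma0 N) 2), IsNewformOf W f →
      ∃ n : ℕ, ‖PowerSeries.coeff n (padicLFunction f (unitRoot W 3 : ℚ_[3]))‖ = 1) :
    Typed.MissingUpperBoundAt W 3 :=
  missingUpperBoundAt_three_rankOne_of_katoMuTransferThree_anyImage W hS hPR mazur_tate_sigma_exists_odd_holds
    hmodP hGZK h3 (katoMuTransferThree_of_fine hfine) (kato_divisibility_three_of_fine hfine W) hX hr1 hSch
    hcertA

/-- **N2 ∩ {r = 1} at a pair with `ord₃ #Ш(E/ℚ)_an = 0`: F1 ∧ the certificates ⟹ Miller's `BSD(E,3)`**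
(GEN 35's `bsdp_three_rankOne_of_katoMuTransferThree_of_shaAn_unit`, `hT3`/`hK`/`hMT` discharged).
Binders left: F1; PUBLISHED `hS`, `hPR`, `hmodP`, `hGZK`, `h3`; certificates `hcertA`, `hSch`, `hunit`.
[cite: Kato2004Asterisque, Thm. 17.4 (2) (p. 273) and §17.13 (pp. 279–280)] [cite: PerrinRiou1987, §1.4 Cor. 1.8]
[cite: BalakrishnanMullerStein2015, Thm. 1.7] [cite: Miller2011LMS, Def. 1.1 (arXiv:1010.2431 p. 3)] -/
theorem bsdp_three_rankOne_of_fine_of_shaAn_unit (hfine : exists_divisibilityInputs_fineQuotient_zeta)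
    (hS : Schneider1985_order_charGenerator_odd) (hPR : perrinRiou_rankOne_leadingTerms_odd)
    (hmodP : nonempty_modularParametrizationData)
    (hGZK : rank_eq_analyticRank_of_analyticRank_le_one)
    (h3 : realPeriodRat_eq_unit_mul_plusPeriod_three)
    (hX : ClassX10 W 3) (hns : ¬ Surj W 3) (hr1 : W.analyticRank = 1)
    (hSch : ∀ Dh : PAdicHeightData W 3, Dh.IsCanonical → SchneiderConjecture Dh)
    (hcertA : ∀ {N : ℕ} [NeZero N] (f : CuspForm (Gamma0 N) 2), IsNewformOf W f →
      ∃ n : ℕ, ‖PowerSeries.coeff n (padicLFunction f (unitRoot W 3 : ℚ_[3]))‖ = 1)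
    (hunit : ∃ q : ℚ, shaAn W = (q : ℂ) ∧ padicValRat 3 q = 0) : BSDp W 3 :=
  bsdp_three_rankOne_of_katoMuTransferThree_of_shaAn_unit W hS hPR mazur_tate_sigma_exists_odd_holds hmodP
    hGZK h3 (katoMuTransferThree_of_fine hfine) (kato_divisibility_three_of_fine hfine W) hX hns hr1 hSch
    hcertA hunit

/-- **Class X10 ∩ {r = 1}, EITHER image, at a pair with `ord₃ #Ш(E/ℚ)_an = 0`: F1 ∧ the certificates ⟹
Miller's `BSD(E,3)`** (GEN 35's `…_anyImage` form, `hT3`/`hK`/`hMT` discharged).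
[cite: Kato2004Asterisque, Thm. 17.4 (2), (3) (p. 273) and §17.13 (pp. 279–280)] [cite: PerrinRiou1987, §1.4 Cor. 1.8]
[cite: BalakrishnanMullerStein2015, Thm. 1.7] [cite: Miller2011LMS, Def. 1.1 (arXiv:1010.2431 p. 3)] -/
theorem bsdp_three_rankOne_of_fine_of_shaAn_unit_anyImage
    (hfine : exists_divisibilityInputs_fineQuotient_zeta)
    (hS : Schneider1985_order_charGenerator_odd) (hPR : perrinRiou_rankOne_leadingTerms_odd)
    (hmodP : nonempty_modularParametrizationData)
    (hGZK : rank_eq_analyticRank_of_analyticRank_le_one)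
    (h3 : realPeriodRat_eq_unit_mul_plusPeriod_three)
    (hX : ClassX10 W 3) (hr1 : W.analyticRank = 1)
    (hSch : ∀ Dh : PAdicHeightData W 3, Dh.IsCanonical → SchneiderConjecture Dh)
    (hcertA : ∀ {N : ℕ} [NeZero N] (f : CuspForm (Gamma0 N) 2), IsNewformOf W f →
      ∃ n : ℕ, ‖PowerSeries.coeff n (padicLFunction f (unitRoot W 3 : ℚ_[3]))‖ = 1)
    (hunit : ∃ q : ℚ, shaAn W = (q : ℂ) ∧ padicValRat 3 q = 0) : BSDp W 3 :=
  bsdp_three_rankOne_of_katoMuTransferThree_of_shaAn_unit_anyImage W hS hPR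
    mazur_tate_sigma_exists_odd_holds hmodP hGZK h3 (katoMuTransferThree_of_fine hfine)
    (kato_divisibility_three_of_fine hfine W) hX hr1 hSch hcertA hunit

end RankOne

/-! ### §4. Both ranks: N2, and class X10 with either image, modulo F1 -/

section BothRanks

variable (W : WeierstrassCurve ℚ) [W.IsElliptic] [W.IsGloballyMinimal]

/-- **N2 (BOTH ranks) at a pair with `ord₃ #Ш(E/ℚ)_an = 0`: F1 ∧ the finite certificates ⟹ Miller's
`BSD(E,3)`** — supersedes GEN 40's `bsdp_three_of_fine_of_shaAn_unit_onClassX10b` (which still carried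
Kato's Thm. 17.4 at the pair, `hK`) and `bsdp_three_of_thm12_4_of_fine_of_shaAn_unit_onClassX10b` (Thm.
12.4): `hK` is now `kato_divisibility_three_of_fine hfine`.  Binders left: F1 (`hfine`); PUBLISHED
`hS` (Schneider 1985 / BMS Thm. 1.7, odd `p`), `hPR` (Perrin-Riou 1987, used at `r = 1` only), `hmodP`,
`hGZK`, `h3` (period unit at `3`); finite per-pair certificates `hcertA` (unit coefficient), `hunit`
(`3 ∤ #Ш_an`), `hSch` (at `r = 1`, rider I1).  On the census of record: 292 of the 313 N2 cells.  No
rational main conjecture, no flag; nothing booked.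
[cite: Kato2004Asterisque, Thm. 12.6 (p. 222), Thm. 17.4 (2) (p. 273) and §17.13 (pp. 279–280)]
[cite: PerrinRiou1987, §1.4 Cor. 1.8] [cite: BalakrishnanMullerStein2015, Thm. 1.7]
[cite: GreenbergLNM1716, §1 Conj. 1.11 and Thm. 4.1 (p. 102)] [cite: Miller2011LMS, Def. 1.1 (arXiv:1010.2431 p. 3)] -/
theorem bsdp_three_onClassX10b_of_fine_of_shaAn_unit (hfine : exists_divisibilityInputs_fineQuotient_zeta)
    (hS : Schneider1985_order_charGenerator_odd) (hPR : perrinRiou_rankOne_leadingTerms_odd)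
    (hmodP : nonempty_modularParametrizationData)
    (hGZK : rank_eq_analyticRank_of_analyticRank_le_one)
    (h3 : realPeriodRat_eq_unit_mul_plusPeriod_three)
    (hX : ClassX10 W 3) (hns : ¬ Surj W 3)
    (hSch : W.analyticRank = 1 → ∀ Dh : PAdicHeightData W 3, Dh.IsCanonical → SchneiderConjecture Dh)
    (hcertA : ∀ {N : ℕ} [NeZero N] (f : CuspForm (Gamma0 N) 2), IsNewformOf W f →
      ∃ n : ℕ, ‖PowerSeries.coeff n (padicLFunction f (unitRoot W 3 : ℚ_[3]))‖ = 1)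
    (hunit : ∃ q : ℚ, shaAn W = (q : ℂ) ∧ padicValRat 3 q = 0) : BSDp W 3 :=
  bsdp_three_of_fine_of_shaAn_unit_onClassX10b W hS hPR hmodP hGZK h3 hfine
    (kato_divisibility_three_of_fine hfine W) hX hns hSch hcertA hunit

/-- **Class X10 (EITHER mod-`3` image, BOTH ranks) at a pair with `ord₃ #Ш(E/ℚ)_an = 0`: F1 ∧ the finite
certificates ⟹ Miller's `BSD(E,3)`** — `ClassX10 W 3` splits the pair into analytic rank `0`
(`bsdp_three_rankZero_of_fine_of_shaAn_unit_anyImage`) or `1`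
(`bsdp_three_rankOne_of_fine_of_shaAn_unit_anyImage`, Schneider certificate).  On X10a′ (surjective
image) the road runs through the good-ordinary tower and Kato (3), the unit-coefficient certificate being
idle there; on X10b through the `μ`-transfer.  No image hypothesis, no rational main conjecture, no flag
(Yan–Zhu unused); nothing booked.
[cite: Kato2004Asterisque, Thm. 12.6 (p. 222), Thm. 17.4 (2), (3) (p. 273) and §17.13 (pp. 279–280)]
[cite: Wuthrich2014, Lemma 20 (p. 399)] [cite: PerrinRiou1987, §1.4 Cor. 1.8]
[cite: BalakrishnanMullerStein2015, Thm. 1.7] [cite: Miller2011LMS, Def. 1.1 (arXiv:1010.2431 p. 3)] -/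
theorem bsdp_three_onClassX10_of_fine_of_shaAn_unit (hfine : exists_divisibilityInputs_fineQuotient_zeta)
    (hS : Schneider1985_order_charGenerator_odd) (hPR : perrinRiou_rankOne_leadingTerms_odd)
    (hmodP : nonempty_modularParametrizationData)
    (hGZK : rank_eq_analyticRank_of_analyticRank_le_one)
    (h3 : realPeriodRat_eq_unit_mul_plusPeriod_three) (hX : ClassX10 W 3)
    (hSch : W.analyticRank = 1 → ∀ Dh : PAdicHeightData W 3, Dh.IsCanonical → SchneiderConjecture Dh)
    (hcertA : ∀ {N : ℕ} [NeZero N] (f : CuspForm (Gamma0 N) 2), IsNewformOf W f →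
      ∃ n : ℕ, ‖PowerSeries.coeff n (padicLFunction f (unitRoot W 3 : ℚ_[3]))‖ = 1)
    (hunit : ∃ q : ℚ, shaAn W = (q : ℂ) ∧ padicValRat 3 q = 0) : BSDp W 3 := by
  rcases hX.2.2.2 with ⟨hr0, -⟩ | ⟨hr1, -⟩
  · exact bsdp_three_rankZero_of_fine_of_shaAn_unit_anyImage W hfine hS hmodP hGZK h3 hX hr0 hcertA hunit
  · exact bsdp_three_rankOne_of_fine_of_shaAn_unit_anyImage W hfine hS hPR hmodP hGZK h3 hX hr1 (hSch hr1)
      hcertA hunit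

end BothRanks

/-! ### §5. The same read off a literal integer model — the RECORD shapes, modulo F1 -/

namespace MuZeroRoad

/-- **F1 ∧ certificate ∧ `ord₃ #Ш(E/ℚ)_an = 0` ⟹ Miller's `BSD(E,3)`, for a cell given by a literal integer
model** `[a1,a2,a3,a4,a6]` (`integralModelInt W`) — GEN 36's
`MuZeroRoad.bsdp_three_of_ainvs_of_katoMuTransferThree_of_shaAn_unit` with `hkato`, `hT3`, `hMT` discharged:
good ordinary `3` and `E[3]` irreducible are READ OFF the model by the `decide`-able certificates (`3 ∤ Δ`,
the point count `n3` at `3` with `3 ∤ 4 − n3`, one good prime `ℓ ∤ 6Δ` whose Frobenius polynomial has no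
root mod `3`), EITHER image.  Census binders per cell: `hL`, `hcertA`, `hunit`.  Per pair; nothing booked.
[cite: Kato2004Asterisque, Thm. 17.4 (2), (3) (p. 273) and §17.13 (pp. 279–280)] [cite: Mazur1978, §6 Prop. 6.3 (1) (p. 153)]
[cite: GreenbergLNM1716, §1 Conj. 1.11 and Thm. 4.1] [cite: Miller2011LMS, Def. 1.1 (arXiv:1010.2431 p. 3)] -/
theorem bsdp_three_of_ainvs_of_fine_of_shaAn_unit (hfine : exists_divisibilityInputs_fineQuotient_zeta)
    (hS : Schneider1985_order_charGenerator_odd) (hmodP : nonempty_modularParametrizationData)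
    (hGZK : rank_eq_analyticRank_of_analyticRank_le_one)
    (h3 : realPeriodRat_eq_unit_mul_plusPeriod_three)
    (a1 a2 a3 a4 a6 : ℤ) {W : WeierstrassCurve ℚ} [W.IsElliptic] [W.IsGloballyMinimal]
    (hW : integralModelInt W = ⟨a1, a2, a3, a4, a6⟩)
    (ℓ n n3 : ℕ) [Fact ℓ.Prime]
    (h3Δ : ¬ (3 : ℤ) ∣ discOf [a1, a2, a3, a4, a6])
    (hc3 : countPoints [a1, a2, a3, a4, a6] 3 = n3) (hord3 : ¬ (3 : ℤ) ∣ (3 : ℤ) + 1 - n3)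
    (hℓ2 : ℓ ≠ 2) (hℓ3 : ℓ ≠ 3) (hℓΔ : ¬ (ℓ : ℤ) ∣ discOf [a1, a2, a3, a4, a6])
    (hc : countPoints [a1, a2, a3, a4, a6] ℓ = n)
    (hnoroot : ∀ t : ℕ, t < 3 → ¬ (3 : ℤ) ∣ (t : ℤ) ^ 2 - ((ℓ : ℤ) + 1 - n) * t + ℓ)
    (hL : W.entireLFunction 1 ≠ 0)
    (hcertA : ∀ {N : ℕ} [NeZero N] (f : CuspForm (Gamma0 N) 2), IsNewformOf W f →
      ∃ n : ℕ, ‖PowerSeries.coeff n (padicLFunction f (unitRoot W 3 : ℚ_[3]))‖ = 1)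
    (hunit : ∃ q : ℚ, shaAn W = (q : ℂ) ∧ padicValRat 3 q = 0) : BSDp W 3 :=
  bsdp_three_of_ainvs_of_katoMuTransferThree_of_shaAn_unit (kato_divisibility_of_fine hfine) hS
    mazur_tate_sigma_exists_odd_holds hmodP hGZK h3 (katoMuTransferThree_of_fine hfine) a1 a2 a3 a4 a6 hW
    ℓ n n3 h3Δ hc3 hord3 hℓ2 hℓ3 hℓΔ hc hnoroot hL hcertA hunit

/-- **F1 ∧ certificate ∧ the booked `BSD(E,3)` ⟹ X_A3 at the pair, `MazurMainConjecture W 3`, for a cell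
given by a literal integer model** — GEN 35's
`MuZeroRoad.mazurMainConjecture_three_of_ainvs_of_katoMuTransferThree_of_bsdp` with `hkato`, `hT3`, `hMT`
discharged; EITHER image.  Every GEN 34 record `mazurMainConjecture_e<label>_of_greenbergMu` upgrades by
this theorem with the same cell data.  Per pair; no class statement; nothing booked.
[cite: Kato2004Asterisque, Thm. 17.4 (2), (3) (p. 273) and §17.13 (pp. 279–280)]
[cite: GreenbergLNM1716, §1 Conj. 1.11 and §5 (closing examples)] [cite: Mazur1978, §6 Prop. 6.3 (1) (p. 153)] -/
theorem mazurMainConjecture_three_of_ainvs_of_fine_of_bsdp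
    (hfine : exists_divisibilityInputs_fineQuotient_zeta)
    (hS : Schneider1985_order_charGenerator_odd) (hmodP : nonempty_modularParametrizationData)
    (hGZK : rank_eq_analyticRank_of_analyticRank_le_one)
    (h3 : realPeriodRat_eq_unit_mul_plusPeriod_three)
    (a1 a2 a3 a4 a6 : ℤ) {W : WeierstrassCurve ℚ} [W.IsElliptic] [W.IsGloballyMinimal]
    (hW : integralModelInt W = ⟨a1, a2, a3, a4, a6⟩)
    (ℓ n n3 : ℕ) [Fact ℓ.Prime]
    (h3Δ : ¬ (3 : ℤ) ∣ discOf [a1, a2, a3, a4, a6])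
    (hc3 : countPoints [a1, a2, a3, a4, a6] 3 = n3) (hord3 : ¬ (3 : ℤ) ∣ (3 : ℤ) + 1 - n3)
    (hℓ2 : ℓ ≠ 2) (hℓ3 : ℓ ≠ 3) (hℓΔ : ¬ (ℓ : ℤ) ∣ discOf [a1, a2, a3, a4, a6])
    (hc : countPoints [a1, a2, a3, a4, a6] ℓ = n)
    (hnoroot : ∀ t : ℕ, t < 3 → ¬ (3 : ℤ) ∣ (t : ℤ) ^ 2 - ((ℓ : ℤ) + 1 - n) * t + ℓ)
    (hL : W.entireLFunction 1 ≠ 0)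
    (hcertA : ∀ {N : ℕ} [NeZero N] (f : CuspForm (Gamma0 N) 2), IsNewformOf W f →
      ∃ n : ℕ, ‖PowerSeries.coeff n (padicLFunction f (unitRoot W 3 : ℚ_[3]))‖ = 1)
    (hbsd : BSDp W 3) : MazurMainConjecture W 3 :=
  mazurMainConjecture_three_of_ainvs_of_katoMuTransferThree_of_bsdp (kato_divisibility_of_fine hfine) hS
    mazur_tate_sigma_exists_odd_holds hmodP hGZK h3 (katoMuTransferThree_of_fine hfine) a1 a2 a3 a4 a6 hW
    ℓ n n3 h3Δ hc3 hord3 hℓ2 hℓ3 hℓΔ hc hnoroot hL hcertA hbsd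

/-- **F1 ∧ certificate ⟹ `ord₃ #Ш(E/ℚ) ≤ ord₃ #Ш(E/ℚ)_an`, for a cell given by a literal integer model** —
GEN 35's `MuZeroRoad.missingUpperBoundAt_three_of_ainvs_of_katoMuTransferThree` with `hkato`, `hT3`,
`hMT` discharged; EITHER image.  Per pair; nothing booked.
[cite: Kato2004Asterisque, Thm. 17.4 (2), (3) (p. 273) and §17.13 (pp. 279–280)]
[cite: GreenbergLNM1716, §1 Conj. 1.11 and Thm. 4.1] [cite: Mazur1978, §6 Prop. 6.3 (1) (p. 153)] -/
theorem missingUpperBoundAt_three_of_ainvs_of_fine (hfine : exists_divisibilityInputs_fineQuotient_zeta)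
    (hS : Schneider1985_order_charGenerator_odd) (hmodP : nonempty_modularParametrizationData)
    (hGZK : rank_eq_analyticRank_of_analyticRank_le_one)
    (h3 : realPeriodRat_eq_unit_mul_plusPeriod_three)
    (a1 a2 a3 a4 a6 : ℤ) {W : WeierstrassCurve ℚ} [W.IsElliptic] [W.IsGloballyMinimal]
    (hW : integralModelInt W = ⟨a1, a2, a3, a4, a6⟩)
    (ℓ n n3 : ℕ) [Fact ℓ.Prime]
    (h3Δ : ¬ (3 : ℤ) ∣ discOf [a1, a2, a3, a4, a6])
    (hc3 : countPoints [a1, a2, a3, a4, a6] 3 = n3) (hord3 : ¬ (3 : ℤ) ∣ (3 : ℤ) + 1 - n3)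
    (hℓ2 : ℓ ≠ 2) (hℓ3 : ℓ ≠ 3) (hℓΔ : ¬ (ℓ : ℤ) ∣ discOf [a1, a2, a3, a4, a6])
    (hc : countPoints [a1, a2, a3, a4, a6] ℓ = n)
    (hnoroot : ∀ t : ℕ, t < 3 → ¬ (3 : ℤ) ∣ (t : ℤ) ^ 2 - ((ℓ : ℤ) + 1 - n) * t + ℓ)
    (hL : W.entireLFunction 1 ≠ 0)
    (hcertA : ∀ {N : ℕ} [NeZero N] (f : CuspForm (Gamma0 N) 2), IsNewformOf W f →
      ∃ n : ℕ, ‖PowerSeries.coeff n (padicLFunction f (unitRoot W 3 : ℚ_[3]))‖ = 1) :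
    Typed.MissingUpperBoundAt W 3 :=
  missingUpperBoundAt_three_of_ainvs_of_katoMuTransferThree (kato_divisibility_of_fine hfine) hS
    mazur_tate_sigma_exists_odd_holds hmodP hGZK h3 (katoMuTransferThree_of_fine hfine) a1 a2 a3 a4 a6 hW
    ℓ n n3 h3Δ hc3 hord3 hℓ2 hℓ3 hℓΔ hc hnoroot hL hcertA

end MuZeroRoad


end Summit.BirchSwinnertonDyer.Rank1Residual.X10

end
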